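import Summits.NavierStokesRegularity.NavierStokesRegularity.Theorems.CalmSliceGateAsymmetricFlickerLiouvilleKilling
import Summits.NavierStokesRegularity.NavierStokesRegularity.Theorems.CalmSliceGateOneSymmetricSliceLimit
import HarnessLib

/-!
# Route `CalmSliceGate`, crux `AsymmetricFlickerLiouville` (stmt-NavierStokesRegularity-24453):
# the registered stub `stub_asymmetryPower` — a one-slice floor of the finite rotation defect about
# an axis yields a definite scale-critical `L²` power of the Killing defect

Theorems file of route `CalmSliceGate` (seat ns-lqd-p2 g4, cell ns-idea-3; `--supports` the wall
crux; critic P1 second lemma). Navier–Stokes regularity is NOT proved here; no summit is; the crux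
itself (`stub_powerLiouville`, how the powers are consumed) stays open.

With `…AsymmetricFlickerLiouvilleKilling` (finite-defect floor ⇒ Killing power at `t = −1`,
uniformly over the class and the axis) the stub follows by the Navier–Stokes scaling: the finite
defect is scale invariant (`OneSymmetricSlice.Birth.symmetryDefect_nsRescale`), the Killing defect
of `nsRescale √(−t) w` at `(−1, z)` is `√(−t)` times that of `w` at `(t, √(−t) z)`
(`killing_nsRescale`, chain rule `fderiv_nsRescale` and linearity of `g J g⁻¹`), the Killing
defect is the angular derivative at `θ = 0` of the finite defect (`deriv_defect_zero`), and the
change of variables `x = √(−t) z` produces the factor `(−t)^{3/2}`.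
-/

noncomputable section

-- the summit and its single sub-problem share the name (CONVENTIONS §1), as in every Theorems file
set_option linter.dupNamespace false

namespace Summit.NavierStokesRegularity.NavierStokesRegularity.Theorems.AsymmetricFlickerLiouville.Birth

open MeasureTheory Set Filter Topology Metric Function Real
open Literature.Analysis Literature.Analysis.FluidPDE
open scoped ENNReal NNReal

/-- `g J g⁻¹` is homogeneous: `gJg⁻¹(c u) = c • gJg⁻¹ u`. [folklore] -/
theorem conjGen_smul (g : EuclideanSpace ℝ (Fin 3) ≃ₗᵢ[ℝ] EuclideanSpace ℝ (Fin 3)) (c : ℝ)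
    (u : EuclideanSpace ℝ (Fin 3)) : g (rotGen (g.symm (c • u))) = c • g (rotGen (g.symm u)) := by
  rw [map_smul, ← rotGenL_apply, map_smul, rotGenL_apply, map_smul]

/-- **The Killing defect under the Navier–Stokes scaling**: for `t < 0`, `μ = √(−t)` and
`v = nsRescale μ w`, `𝓛_{v(−1)}(z) = √(−t) • 𝓛_{w(t)}(μ z)` (chain rule for the rescaled slice,
homogeneity of `gJg⁻¹`). [cite: KochNadirashviliSereginSverak2009, §1 (1.2) (arXiv:0709.3599 p. 2)] -/
theorem killing_nsRescale (w : ℝ → EuclideanSpace ℝ (Fin 3) → EuclideanSpace ℝ (Fin 3)) {t : ℝ}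
    (ht : t < 0) (g : EuclideanSpace ℝ (Fin 3) ≃ₗᵢ[ℝ] EuclideanSpace ℝ (Fin 3)) (z : EuclideanSpace ℝ (Fin 3)) :
    fderiv ℝ (nsRescale (Real.sqrt (-t)) w (-1)) z (g (rotGen (g.symm z))) -
        g (rotGen (g.symm (nsRescale (Real.sqrt (-t)) w (-1) z))) =
      Real.sqrt (-t) • (fderiv ℝ (w t) (Real.sqrt (-t) • z) (g (rotGen (g.symm (Real.sqrt (-t) • z)))) -
        g (rotGen (g.symm (w t (Real.sqrt (-t) • z))))) := by
  set μ : ℝ := Real.sqrt (-t) with hμ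
  have hμt : μ ^ 2 * (-1) = t := by rw [hμ, Real.sq_sqrt (neg_nonneg.2 ht.le)]; ring
  rw [RecurrentReductionD.fderiv_nsRescale, nsRescale_apply, hμt, conjGen_smul g μ (w t (μ • z)),
    conjGen_smul g μ z, map_smul, smul_sub]
  have hS : ((μ * μ) • fderiv ℝ (w t) (μ • z)) (g (rotGen (g.symm z))) =
      (μ * μ) • fderiv ℝ (w t) (μ • z) (g (rotGen (g.symm z))) := rfl
  rw [hS, smul_smul]

/-- **`stub_asymmetryPower`** (registered stub of `AsymmetricFlickerLiouville`, critic P1 second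
lemma): there is `c' = c'(C, δ', R') > 0` such that for every Type-I ancient mild field `w`
(constant `C`), every `t < 0` and every axis `g e₃`, a one-point floor `δ'/√(−t)` of the finite
rotation defect at some angle and some `‖x‖ < R'√(−t)` forces
`∫_{B(0,2R'√(−t))} ‖√(−t) (d/dθ)|₀(w(t, gR_θg⁻¹x) − gR_θg⁻¹w(t,x))‖² dx ≥ c'(−t)^{3/2}`.
[cite: KochNadirashviliSereginSverak2009, §4 (4.10) (arXiv:0709.3599 p. 8)] -/
theorem stub_asymmetryPower (C δ' R' : ℝ) (hδ' : 0 < δ') (hR' : 0 < R') :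
    ∃ c' > 0, ∀ w : ℝ → EuclideanSpace ℝ (Fin 3) → EuclideanSpace ℝ (Fin 3),
      IsTypeIAncientMild C w → ∀ t < 0, ∀ g : EuclideanSpace ℝ (Fin 3) ≃ₗᵢ[ℝ] EuclideanSpace ℝ (Fin 3),
        (∃ θ : ℝ, ∃ x ∈ Metric.ball (0 : EuclideanSpace ℝ (Fin 3)) (R' * Real.sqrt (-t)),
          δ' < Real.sqrt (-t) * ‖w t (g (rotZ θ (g.symm x))) - g (rotZ θ (g.symm (w t x)))‖) →
        ENNReal.ofReal (c' * (-t) ^ (3 / 2 : ℝ)) ≤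
          ∫⁻ x in Metric.ball (0 : EuclideanSpace ℝ (Fin 3)) (2 * R' * Real.sqrt (-t)),
            ‖Real.sqrt (-t) • deriv (fun θ : ℝ => w t (g (rotZ θ (g.symm x))) -
              g (rotZ θ (g.symm (w t x)))) 0‖ₑ ^ 2 := by
  obtain ⟨c', hc', hpow⟩ := exists_killing_power_of_defect C δ' R' hδ' hR'
  refine ⟨c', hc', fun w hw t ht g hfloor => ?_⟩
  set μ : ℝ := Real.sqrt (-t) with hμ
  have hμpos : 0 < μ := Real.sqrt_pos.2 (neg_pos.2 ht)
  have hμne : μ ≠ 0 := hμpos.ne'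
  set v : ℝ → EuclideanSpace ℝ (Fin 3) → EuclideanSpace ℝ (Fin 3) := nsRescale μ w with hv
  have hvcl : IsTypeIAncientMild C v := isTypeIAncientMild_nsRescale hw hμpos
  have hwt : ContDiff ℝ 1 (w t) := (hw.contDiff_slice ht).of_le (by exact_mod_cast le_top)
  -- the stub's integrand is the Killing defect of `v(-1)` at `μ⁻¹ x`
  have hE : ∀ x : EuclideanSpace ℝ (Fin 3),
      Real.sqrt (-t) • deriv (fun θ : ℝ => w t (g (rotZ θ (g.symm x))) - g (rotZ θ (g.symm (w t x)))) 0 =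
        fderiv ℝ (v (-1)) (μ⁻¹ • x) (g (rotGen (g.symm (μ⁻¹ • x)))) -
          g (rotGen (g.symm (v (-1) (μ⁻¹ • x)))) := by
    intro x
    rw [deriv_defect_zero hwt g x, hv, killing_nsRescale w ht g (μ⁻¹ • x), ← hμ, smul_smul,
      mul_inv_cancel₀ hμne, one_smul]
  -- the floor transfers to `t = -1`
  have hfloor' : ∃ θ : ℝ, ∃ y ∈ ball (0 : EuclideanSpace ℝ (Fin 3)) R',
      δ' < ‖v (-1) (g (rotZ θ (g.symm y))) - g (rotZ θ (g.symm (v (-1) y)))‖ := by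
    obtain ⟨θ, x, hx, hδx⟩ := hfloor
    refine ⟨θ, μ⁻¹ • x, ?_, ?_⟩
    · rw [mem_ball_zero_iff] at hx ⊢
      rw [norm_smul, norm_inv, Real.norm_of_nonneg hμpos.le, inv_mul_lt_iff₀ hμpos]
      linarith [mul_comm R' μ]
    · rw [hv, OneSymmetricSlice.Birth.symmetryDefect_nsRescale w ht g θ (μ⁻¹ • x), ← hμ, smul_smul,
        mul_inv_cancel₀ hμne, one_smul]
      exact hδx
  have hP := hpow hvcl g hfloor'
  -- change of variables `x = μ z`
  set Gsq : EuclideanSpace ℝ (Fin 3) → ℝ≥0∞ := fun z =>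
    ‖fderiv ℝ (v (-1)) z (g (rotGen (g.symm z))) - g (rotGen (g.symm (v (-1) z)))‖ₑ ^ 2 with hGsq
  have hset : ∀ x : EuclideanSpace ℝ (Fin 3),
      x ∈ ball (0 : EuclideanSpace ℝ (Fin 3)) (2 * R' * μ) ↔
        μ⁻¹ • x ∈ ball (0 : EuclideanSpace ℝ (Fin 3)) (2 * R') := by
    intro x
    rw [mem_ball_zero_iff, mem_ball_zero_iff, norm_smul, norm_inv, Real.norm_of_nonneg hμpos.le,
      inv_mul_lt_iff₀ hμpos]
    constructor <;> intro h <;> linarith [mul_comm (2 * R') μ]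
  have hcv : ∫⁻ x in ball (0 : EuclideanSpace ℝ (Fin 3)) (2 * R' * μ),
      ‖Real.sqrt (-t) • deriv (fun θ : ℝ => w t (g (rotZ θ (g.symm x))) -
        g (rotZ θ (g.symm (w t x)))) 0‖ₑ ^ 2 =
      ENNReal.ofReal (μ ^ 3) * ∫⁻ z in ball (0 : EuclideanSpace ℝ (Fin 3)) (2 * R'), Gsq z := by
    rw [← lintegral_indicator measurableSet_ball, ← lintegral_indicator measurableSet_ball]
    have e : (ball (0 : EuclideanSpace ℝ (Fin 3)) (2 * R' * μ)).indicator (fun x =>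
        ‖Real.sqrt (-t) • deriv (fun θ : ℝ => w t (g (rotZ θ (g.symm x))) -
          g (rotZ θ (g.symm (w t x)))) 0‖ₑ ^ 2) =
        fun x => (ball (0 : EuclideanSpace ℝ (Fin 3)) (2 * R')).indicator Gsq (μ⁻¹ • x + 0) := by
      funext x
      rw [add_zero]
      by_cases hx : x ∈ ball (0 : EuclideanSpace ℝ (Fin 3)) (2 * R' * μ)
      · rw [indicator_of_mem hx, indicator_of_mem ((hset x).1 hx), hGsq, hE x]
      · rw [indicator_of_notMem hx, indicator_of_notMem (fun h => hx ((hset x).2 h))]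
    rw [e, PoincareBall.lintegral_comp_smul_add _ (inv_ne_zero hμne) 0, finrank_euclideanSpace_fin]
    congr 1
    rw [inv_pow, inv_inv, abs_of_pos (pow_pos hμpos 3)]
  have hμ3 : μ ^ 3 = (-t) ^ (3 / 2 : ℝ) := by
    rw [hμ, Real.sqrt_eq_rpow, ← Real.rpow_natCast, ← Real.rpow_mul (neg_nonneg.2 ht.le)]
    norm_num
  rw [hcv, mul_comm c', ENNReal.ofReal_mul (by rw [← hμ3]; positivity), ← hμ3]
  exact mul_le_mul_of_nonneg_left hP bot_le

end Summit.NavierStokesRegularity.NavierStokesRegularity.Theorems.AsymmetricFlickerLiouville.Birth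

end
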